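import Summits.BirchSwinnertonDyer.BirchSwinnertonDyer.Theorems.UniversalToricDescentThinCombFrameValues
import HarnessLib

/-!
# Values of two-variable `R₀`-series under the group-like frame substitution `φ_A`, II: FRAME COVARIANCE of
# `UnrSeries.HasValueAt₂` and of the ♯♯ toric display `IsToricTwoVarLFunctionUpTo₂`
# (helper on the rational wall `RationalSplitIMCInclusionAtThree`, item stmt-BirchSwinnertonDyer-24207, line `ratwall_thin_comb` v7;
# cell `pub/bsd-wall`, LEAD `cruxlead-24207` g6; `--supports stmt-BirchSwinnertonDyer-24207`)

WHY THIS FILE (LEAD-CENSUS-g5 §5 (h2)). Part I (`…ThinComb.FrameValues`, file `UniversalToricDescentThinCombFrameValues.lean`) proved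
that the tree's value predicate `UnrSeries.HasValueAt₂` is Mathlib's topological evaluation along `R₀ → 𝓞_{ℂ_p}`, that evaluation
commutes with substitution, and that the frame image `(1+T₁)^{A 0 j}(1+T₂)^{A 1 j} − 1` takes at `(r γ₁ − 1, r γ₂ − 1)` the value
`r(g_j) − 1` (column `j` of `A` = coordinates of `g_j`). This part assembles the dictionary the two halves of the v7 stub
`stub_toricExistsSymmUpTo2` are read through:

* **`hasValueAt₂_frameSubst_iff`** — for a generator pair `(κ₁, κ₂; γ₁, γ₂)`, a character `r` through the pair, `g₁, g₂ ∈ Γ_K` and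
  `A = frameMatrixOf κ₁ κ₂ g₁ g₂ id ∈ GL₂(ℤ_p)`: `φ_A L` has the value `w` at `(r γ₁ − 1, r γ₂ − 1)` IFF `L` has the value `w` at
  `(r g₁ − 1, r g₂ − 1)`; `σ`-form **`hasValueAt₂_frameSubst_frameMatrixOf_iff`** (`A = frameMatrixOf κ₁ κ₂ γ₁ γ₂ σ`, values at
  `r(σγ_i) − 1`) — exactly the shape of the stubs (`σ = τ`, a lift of `g ↦ c g⁻¹ c⁻¹`, `A = A_τ` the frame involution).
* **`isToricTwoVarLFunctionUpTo₂_frameSubst`** — `IsToricTwoVarLFunctionUpTo₂` IS FRAME-COVARIANT: a ♯♯-frame `L₂` for a pair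
  `(κ₁′, κ₂′; γ₁′, γ₂′)` of the same (or a bigger) tower gives the ♯♯-frame `φ_A L₂` for `(κ₁, κ₂; γ₁, γ₂)`,
  `A = frameMatrixOf κ₁ κ₂ γ₁′ γ₂′ id`, with the SAME constants `C, X, Y` and period: a typed existence theorem (Hao–Loeffler 2025,
  Thm. 3.5) in ONE frame feeds the 𝔭-adapted frame the line consumes.

Theorems only (no definition, no instance, no notation, no `sorry`); nothing about elliptic curves is proved; BSD is not proved
by any of this; 24207 stays OPEN.

References: Neukirch–Schmidt–Wingberg (5.3.5) [cite: NeukirchSchmidtWingberg2008, (5.3.5)]; Bourbaki, *Algebra* II, Ch. IV §4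
[cite: BourbakiAlgebraII2003, Ch. IV §4]; de Shalit II.4.17 (54) [cite: deShalit1987, II.4.17 (54)]; Castella–Wan §2.4 Thm. 2.11
[cite: CastellaWan2023, §2.4 Thm. 2.11 (arXiv:1607.02019)]; Hao–Loeffler Thm. 3.5 [cite: HaoLoeffler2025, Thm. 3.5 (arXiv:2405.12611)];
Büyükboduk–Lei Def. 3.8 [cite: BuyukbodukLei2017, Def. 3.8 (arXiv:1707.00557)].
-/

set_option linter.dupNamespace false
set_option autoImplicit false

noncomputable section

open scoped MatrixGroups
open Filter Topology Field
open Literature.NumberTheory.EllipticCurves Literature.NumberTheory.IwasawaTheory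
open Literature.NumberTheory.GaloisRepresentations

namespace Summit.BirchSwinnertonDyer.BirchSwinnertonDyer.Theorems.UniversalToricDescentThinComb.FrameCovariance

open Summit.BirchSwinnertonDyer.Rank1Residual.X11b.Halves
open Summit.BirchSwinnertonDyer.BirchSwinnertonDyer.Theorems.UniversalToricDescentThinComb.FrameValues

/-! ## Frame covariance of `HasValueAt₂` and of `IsToricTwoVarLFunctionUpTo₂` -/

section Covariance

variable {p : ℕ} [Fact p.Prime] {K : Type} [Field K] [NumberField K]
  {κ₁ κ₂ : ZpExtension K p} {γ₁ γ₂ : absoluteGaloisGroup K} {r : FramedGaloisRep K (PadicAlgCl p) 1}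

/-- **FRAME COVARIANCE OF VALUES.** Let `(κ₁, κ₂; γ₁, γ₂)` be a generator pair of the `ℤ_p²`-tower, `r` a character through the
pair, `g₁, g₂ ∈ Γ_K`, and `A ∈ GL₂(ℤ_p)` the matrix of their additive coordinates, `A = frameMatrixOf κ₁ κ₂ g₁ g₂ id` (column
`j` = `(κ₁ g_j, κ₂ g_j)`). Then `φ_A L` has the value `w` at `(r γ₁ − 1, r γ₂ − 1)` IFF `L` has the value `w` at
`(r g₁ − 1, r g₂ − 1)`: `(φ_A L)(r) = L(r g₁ − 1, r g₂ − 1)`. Proof: `φ_A L = L ∘ (frame images)` and evaluation commutes with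
substitution (Part I §1–§2); the frame images take the values `r g_j − 1` (Part I §3); values are unique `HasSum` limits.
[cite: NeukirchSchmidtWingberg2008, (5.3.5)] [cite: BourbakiAlgebraII2003, Ch. IV §4] [cite: deShalit1987, II.4.17 (54)] -/
theorem hasValueAt₂_frameSubst_iff (hpair : ZpExtension.IsTopGeneratorPair κ₁ κ₂ γ₁ γ₂) (hr : FactorsThroughPair κ₁ κ₂ r)
    (g₁ g₂ : absoluteGaloisGroup K) (A : GL (Fin 2) ℤ_[p])
    (hA : (A : Matrix (Fin 2) (Fin 2) ℤ_[p]) = IwasawaAlgebra₂.frameMatrixOf κ₁ κ₂ g₁ g₂ id)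
    (L : PowerSeries (UnrSeries p)) (w : ℂ_[p]) :
    letI : Algebra ℤ_[p] (unrIntegers p) := (toUnr p).toAlgebra
    UnrSeries.HasValueAt₂ (IwasawaAlgebra₂.frameSubst (unrIntegers p) A L) (avatarValueAt r γ₁ - 1)
        (avatarValueAt r γ₂ - 1) w ↔
      UnrSeries.HasValueAt₂ L (avatarValueAt r g₁ - 1) (avatarValueAt r g₂ - 1) w := by
  letI : Algebra ℤ_[p] (unrIntegers p) := (toUnr p).toAlgebra
  haveI := completeSpace_padicComplexInt p
  haveI := isLinearTopology_padicComplexInt p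
  -- the two points, as elements of `𝓞_{ℂ_p}` of norm `< 1`
  set u : 𝓞_ℂ_[p] := ⟨avatarValueAt r γ₁ - 1, avatarValueAt_sub_one_mem hr γ₁⟩ with hu_def
  set v : 𝓞_ℂ_[p] := ⟨avatarValueAt r γ₂ - 1, avatarValueAt_sub_one_mem hr γ₂⟩ with hv_def
  have hu : (u : ℂ_[p]) = avatarValueAt r γ₁ - 1 := rfl
  have hv : (v : ℂ_[p]) = avatarValueAt r γ₂ - 1 := rfl
  have hu1 : ‖u‖ < 1 := norm_avatarValueAt_sub_one_lt_of_factorsThroughPair hr γ₁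
  have hv1 : ‖v‖ < 1 := norm_avatarValueAt_sub_one_lt_of_factorsThroughPair hr γ₂
  set u' : 𝓞_ℂ_[p] := MvPowerSeries.eval₂ (unrToInt (p := p)) ![u, v]
    (IwasawaAlgebra₂.frameImages (unrIntegers p) (A : Matrix (Fin 2) (Fin 2) ℤ_[p]) 0) with hu'_def
  set v' : 𝓞_ℂ_[p] := MvPowerSeries.eval₂ (unrToInt (p := p)) ![u, v]
    (IwasawaAlgebra₂.frameImages (unrIntegers p) (A : Matrix (Fin 2) (Fin 2) ℤ_[p]) 1) with hv'_def
  have hu' : (u' : ℂ_[p]) = avatarValueAt r g₁ - 1 :=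
    coe_eval₂_frameImages hpair hr _ 0 g₁ (by rw [hA]; rfl) (by rw [hA]; rfl) hu hv hu1 hv1
  have hv' : (v' : ℂ_[p]) = avatarValueAt r g₂ - 1 :=
    coe_eval₂_frameImages hpair hr _ 1 g₂ (by rw [hA]; rfl) (by rw [hA]; rfl) hu hv hu1 hv1
  have hu'1 : ‖u'‖ < 1 := by
    change ‖(u' : ℂ_[p])‖ < 1
    rw [hu']
    exact norm_avatarValueAt_sub_one_lt_of_factorsThroughPair hr g₁
  have hv'1 : ‖v'‖ < 1 := by
    change ‖(v' : ℂ_[p])‖ < 1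
    rw [hv']
    exact norm_avatarValueAt_sub_one_lt_of_factorsThroughPair hr g₂
  -- the common value
  have hpt : (fun j ↦ MvPowerSeries.eval₂ (unrToInt (p := p)) ![u, v]
      (IwasawaAlgebra₂.frameImages (unrIntegers p) (A : Matrix (Fin 2) (Fin 2) ℤ_[p]) j)) = ![u', v'] := by
    funext j
    fin_cases j <;> rfl
  have hV₁ := hasValueAt₂_eval₂ (IwasawaAlgebra₂.frameSubst (unrIntegers p) A L) hu1 hv1
  rw [eval₂_frameSubst A L hu1 hv1, hpt] at hV₁
  have hV₂ := hasValueAt₂_eval₂ L hu'1 hv'1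
  rw [hu', hv'] at hV₂
  change UnrSeries.HasValueAt₂ _ (u : ℂ_[p]) (v : ℂ_[p]) w ↔ _
  constructor
  · intro h
    rwa [h.unique hV₁]
  · intro h
    rwa [h.unique hV₂]

/-- **Frame covariance, `σ`-form** (the shape of the v7 stubs of `ratwall_thin_comb`): for ANY map `σ : Γ_K → Γ_K` and
`A = frameMatrixOf κ₁ κ₂ γ₁ γ₂ σ ∈ GL₂(ℤ_p)` (column `j` = coordinates of `σ γ_j`; e.g. `σ = τ`, a lift of `g ↦ c g⁻¹ c⁻¹`, giving
the frame involution `A_τ` of `…ThinComb.FrameInvolution`), `φ_A L` has the value `w` at `(r γ₁ − 1, r γ₂ − 1)` iff `L` has the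
value `w` at `(r(σγ₁) − 1, r(σγ₂) − 1)`. [cite: NeukirchSchmidtWingberg2008, (5.3.5)] [cite: BuyukbodukLei2017, Def. 3.8 (the involution τ)] -/
theorem hasValueAt₂_frameSubst_frameMatrixOf_iff (hpair : ZpExtension.IsTopGeneratorPair κ₁ κ₂ γ₁ γ₂)
    (hr : FactorsThroughPair κ₁ κ₂ r) (σ : absoluteGaloisGroup K → absoluteGaloisGroup K) (A : GL (Fin 2) ℤ_[p])
    (hA : (A : Matrix (Fin 2) (Fin 2) ℤ_[p]) = IwasawaAlgebra₂.frameMatrixOf κ₁ κ₂ γ₁ γ₂ σ)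
    (L : PowerSeries (UnrSeries p)) (w : ℂ_[p]) :
    letI : Algebra ℤ_[p] (unrIntegers p) := (toUnr p).toAlgebra
    UnrSeries.HasValueAt₂ (IwasawaAlgebra₂.frameSubst (unrIntegers p) A L) (avatarValueAt r γ₁ - 1)
        (avatarValueAt r γ₂ - 1) w ↔
      UnrSeries.HasValueAt₂ L (avatarValueAt r (σ γ₁) - 1) (avatarValueAt r (σ γ₂) - 1) w :=
  hasValueAt₂_frameSubst_iff hpair hr (σ γ₁) (σ γ₂) A (by rw [hA]; rfl) L w

omit [NumberField K] in
/-- Characters through a pair are characters through any pair cutting out a SMALLER kernel (a bigger or equal tower);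
for two bases of the same `ℤ_p²`-quotient the kernels coincide. [cite: deShalit1987, II.4.17 (54)] -/
theorem factorsThroughPair_of_pairKer_le {κ₁' κ₂' : ZpExtension K p}
    (hker : ZpExtension.pairKer κ₁' κ₂' ≤ ZpExtension.pairKer κ₁ κ₂) (hr : FactorsThroughPair κ₁ κ₂ r) :
    FactorsThroughPair κ₁' κ₂' r := fun g h₁ h₂ ↦ by
  have hg : g ∈ ZpExtension.pairKer κ₁ κ₂ := hker (ZpExtension.mem_pairKer_iff.mpr ⟨h₁, h₂⟩)
  exact hr g (ZpExtension.mem_pairKer_iff.mp hg).1 (ZpExtension.mem_pairKer_iff.mp hg).2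

/-- **`IsToricTwoVarLFunctionUpTo₂` IS FRAME-COVARIANT.** If `L₂` is a ♯♯-frame of the toric two-variable function for the pair
`(κ₁′, κ₂′; γ₁′, γ₂′)` (constants `C, X, Y`, period `Ω_K`), `(κ₁, κ₂; γ₁, γ₂)` is a generator pair cutting out the same or a
smaller tower (`pairKer κ₁′ κ₂′ ≤ pairKer κ₁ κ₂`: characters through `(κ₁, κ₂)` are characters through `(κ₁′, κ₂′)`), and `A = frameMatrixOf κ₁ κ₂ γ₁′ γ₂′ id ∈ GL₂(ℤ_p)` records the coordinates
of `γ₁′, γ₂′` in the new pair, then `φ_A L₂` is a ♯♯-frame for `(κ₁, κ₂; γ₁, γ₂)` with the SAME `C, X, Y, Ω_K`: at every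
interpolation point `(ψ, a, b, r, L)` of the new frame, `r` is a point of the old frame and `(φ_A L₂)(r γ₁ − 1, r γ₂ − 1) =
L₂(r γ₁′ − 1, r γ₂′ − 1)` is the prescribed value. A typed existence theorem in ONE frame therefore feeds the 𝔭-adapted frame
of the line. [cite: HaoLoeffler2025, Thm. 3.5 (arXiv:2405.12611)] [cite: CastellaWan2023, §2.4 Thm. 2.11 (arXiv:1607.02019)]
[cite: NeukirchSchmidtWingberg2008, (5.3.5)] -/
theorem isToricTwoVarLFunctionUpTo₂_frameSubst {N : ℕ} {ι : PadicAlgCl p ≃+* ℂ}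
    {𝔭 𝔭' : IsDedekindDomain.HeightOneSpectrum (NumberField.RingOfIntegers K)} {κ₁' κ₂' : ZpExtension K p}
    {γ₁' γ₂' : absoluteGaloisGroup K} (hpair : ZpExtension.IsTopGeneratorPair κ₁ κ₂ γ₁ γ₂)
    (hker : ZpExtension.pairKer κ₁' κ₂' ≤ ZpExtension.pairKer κ₁ κ₂) (A : GL (Fin 2) ℤ_[p])
    (hA : (A : Matrix (Fin 2) (Fin 2) ℤ_[p]) = IwasawaAlgebra₂.frameMatrixOf κ₁ κ₂ γ₁' γ₂' id)
    {f : CuspForm (CongruenceSubgroup.Gamma0 N) 2} {ΩK : ℂ} {C X Y : ℂ_[p]} {L₂ : PowerSeries (UnrSeries p)}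
    (hL : IsToricTwoVarLFunctionUpTo₂ C X Y ι 𝔭 𝔭' κ₁' κ₂' γ₁' γ₂' f ΩK L₂) :
    letI : Algebra ℤ_[p] (unrIntegers p) := (toUnr p).toAlgebra
    IsToricTwoVarLFunctionUpTo₂ C X Y ι 𝔭 𝔭' κ₁ κ₂ γ₁ γ₂ f ΩK (IwasawaAlgebra₂.frameSubst (unrIntegers p) A L₂) := by
  letI : Algebra ℤ_[p] (unrIntegers p) := (toUnr p).toAlgebra
  intro ψ a b ha hb hinf hunr r hψr hrκ L hLd hLe
  have hrκ' : FactorsThroughPair κ₁' κ₂' r := factorsThroughPair_of_pairKer_le hker hrκ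
  exact (hasValueAt₂_frameSubst_iff hpair hrκ γ₁' γ₂' A hA L₂ _).mpr
    (hL ψ a b ha hb hinf hunr r hψr hrκ' L hLd hLe)

end Covariance

end Summit.BirchSwinnertonDyer.BirchSwinnertonDyer.Theorems.UniversalToricDescentThinComb.FrameCovariance

end
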